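import Summits.QuantumFields.YangMills.Theorems.BalabanUVNodesProp4AtRecordConeRadius
import Summits.QuantumFields.YangMills.Theorems.BalabanUVNodesN07KLHOfThm312
import HarnessLib

/-!
# [B11] PROP. 4 AT THE RECORD (NODE-00) FROM ONE LETTER FOR `H₁(U₀)` — the consumer corollary of dag-n06-l's ✓`…N07KLHOfThm312` ((KL-H) from the (3.133)-shaped zeroth entry bounds)
# and dag-n07-e's ✓`…N07Prop4LetterHOfThm312` ((ℓa-H) from the same bounds) through the free-radius cone door ✓`prop4UniformAtRecord_node00_of_coneLetter_radius`

Cell `pub-ymgap` ∕ `ym-nodeO-ideate`, porter lineage `ymgap-nodeO-port-PTB-1` (gen 8); ★★ dag-lead g45 WORDS 800 (1): «LETTER = dag-n06-l g42 (`klH_of_h1EntryBounds`); CONSUMER COROLLARY = ★ PT-B g8 — G4 REDUCED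
to `prop4UniformAtRecord_node00_of_h1EntryBounds_coneLetter` keyed BY NAME on n06-l's `klH_of_h1EntryBounds`; do NOT retype the fibre count or the `levWeight…` lemma».  `--kind proof --supports stmt-QuantumFields-27238 --as helper`;
count-neutral.  [B11] = [Balaban1985Variational]; [B9] = [Balaban1985BackgroundPropagators]; [B7] = [Balaban1985Averaging].

WHAT THIS FILE PROVES (0 def, ONE theorem): ★★★ `prop4UniformAtRecord_node00_of_h1EntryBounds_coneLetter` — PROP. 4 (97)–(98) at the record in the node-00 regime (`0 < k ≤ m + K`, every site
in `Ω_k`, any radius `0 < r′ ≤ r(b)`) from: the (3.133)-shaped entry bounds `h1Entry₀,₁ y y′ ≤ B₀e^{−ρd(y,y′)}` of the record's `H₁(U₀)` [⇒ (ℓa-H) with `b = B₀·d(2(1+1∕ρ))^d` by n07-e's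
✓`prop4LetterHAtRecord_of_h1EntryBounds` AND (KL-H) with `hk(b′,y) = ‖h1Col0 y b′‖_op`, `Θ_H = Θ_H^w = L^{kd}·B₀·d(2(1+1∕ρ))^d` by n06-l's ✓`klH_of_h1EntryBounds`], (KL-N) (one-block letter of `Δπ∘H₁`,
displayed), the ON-CONE ENTRY LETTER `‖(D C^{𝔰𝔩}(A)·δ_b X)(c)‖ ≤ g₀‖A‖‖X‖` on `‖A‖ < 2r′` ([B7] (157)'s shape) with the window `2r′·Θ_H·(2d·g₀) ≤ ½`, print's (14) below `k`, `‖J‖ ≤ nJ`.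
ANTECEDENT BY NAME: {(3.133) entry decay of the record's `H₁(U₀)` (= [B9] Thm 3.12; n07-e §4 ∕ n06-l §3 reduce it to `B9.Thm312Printed`) · (KL-N) · `g₀` = [B7] Prop. 5 for the record's averaging · (14) · `nJ`}.

HONEST FRAMING.  Glue; NO estimate; every letter DISPLAYED and unowned as an estimate (★★★ №583); (ℓa-C) only for Ω_j = T; (R1)∕(R2) OPEN; K0ᴬ ⟨stmt-QuantumFields-27238⟩ NOT closed; K0ᴬ∕K1ᴬ∕K3ᴬ 0∕3;
NODE O 0∕1; COUNT 8∕28 · K 1∕4 UNMOVED; finite `𝕋⁴_{L^K}` at fixed ε — NOT continuum ∕ ℝ⁴ ∕ OS; **the Yang–Mills mass gap (Clay) is NOT proved by any of this.**  No `sorry`, `instance`, `notation`,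
`set_option`; standard axioms.
-/

noncomputable section

open scoped Matrix Matrix.Norms.L2Operator InnerProductSpace ComplexConjugate BigOperators

namespace Summit.QuantumFields.YangMills.Theorems.Prop4UniformAtRecord

open Literature.MathematicalPhysics.QuantumFieldTheory.Balaban1983to89
open Literature.MathematicalPhysics.QuantumFieldTheory.Balaban1983to89.Node00
open T4Continuum BlockAveraging
open B10Eq42TorusConstraint (bondsIn)
open B9SectCLatticeCarrier (Bond)
open B11Eq103H1Complex (SiteL2K)
open B11Eq115Space (NegSup NegSize levWeight)
open B11Eq90Transpose (single115)
open B11Eq90V0primeCurrent (flat115)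
open B11Eq111FrakG (nabla115)
open Summit.QuantumFields.YangMills.BalabanUVNodes.N07Prop4LetterHOfThm312 (h1Col0 h1Entry0 h1Entry1 prop4LetterHAtRecord_of_h1EntryBounds)
open Summit.QuantumFields.YangMills.BalabanUVNodes.N07KLHOfThm312 (klH_of_h1EntryBounds)

section Record

variable (F : T4Family) (N : ℕ) [NeZero N] (K k : ℕ) (Ω : ℕ → Set (Site (F.P K) 0)) (U₀ : GaugeField (F.P K) 0 (SU N))
variable [Fact (0 < (F.L : ℝ))] [Fact (0 < (F.P K).eta k)] [Fact (0 < c0Rec F K k)] [Fact (∀ c, 0 < wBRec F K k c)] (levB : PBond (F.P K) k → ℕ) (a : ℝ)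
  (hpos : ∀ x, x ≠ 0 → 0 < RCLike.re ⟪x, laplaceAOfRecord F N k U₀ (QOfRecord F N k U₀) (QflatOfRecord F N k) a x⟫_ℂ)
  (hQ : Function.Surjective (QOfRecord F N k U₀))

/-- ★★★ **[B11] PROP. 4 (97)–(98) AT THE RECORD IN THE NODE-00 REGIME FROM ONE LETTER FOR `H₁(U₀)`** — the (3.133)-shaped entry bounds `h1Entry₀,₁ y y′ ≤ B₀e^{−ρd(y,y′)}`
give BOTH (ℓa-H) (dag-n07-e ✓`prop4LetterHAtRecord_of_h1EntryBounds`, `b = B₀·d(2(1+1∕ρ))^d`) AND (KL-H) (dag-n06-l ✓`klH_of_h1EntryBounds`, `hk = ‖h1Col0‖_op`,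
`Θ_H = Θ_H^w = L^{kd}·B₀·d(2(1+1∕ρ))^d`); the rest as in ✓`prop4UniformAtRecord_node00_of_coneLetter_radius`: (KL-N), the on-cone entry letter `g₀` of `D C^{𝔰𝔩}` on `‖A‖ < 2r′` with window
`2r′·Θ_H·(2d·g₀) ≤ ½`, print's (14) below `k`, `‖J‖ ≤ nJ`, any radius `0 < r′ ≤ r(b)`.  HONEST: glue; the letters are DISPLAYED.
[cite: Balaban1985Variational, Prop. 4 (97)–(98) pp.292–293, (14) p.280, (46) p.285, (86)–(89) p.291; Balaban1985BackgroundPropagators, (3.133) p.422, Thm 3.12 pp.423–424; Balaban1985Averaging, Proposition 5 (157) p.42; Balaban1984PropagatorsII, (2.61) p.234] -/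
theorem prop4UniformAtRecord_node00_of_h1EntryBounds_coneLetter [DecidableEq (PBond (F.P K) k)]
    (Gp : SiteL2K ℂ (F.P K).d (fun _ => (F.P K).sitesPerDir 0) (c0Rec F K k) (WRec N) →ₗ[ℂ]
      SiteL2K ℂ (F.P K).d (fun _ => (F.P K).sitesPerDir 0) (c0Rec F K k) (WRec N))
    {α nJ : ℝ} (hkpos : 0 < k) (hkm : k ≤ (F.P K).m + (F.P K).K) (hΩ : ∀ x, x ∈ Ω k) (hα0 : 0 ≤ α) (hα : α * (11000000 * N) ≤ 1)
    (hreg : ∀ j, j < k → PlaqSmall (α * ((F.L : ℝ) ^ j * (F.P K).eta k) ^ 2) (Averaging.iter (avOfRecord F N K) j U₀))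
    -- the (3.133)-shaped entry bounds of `H₁(U₀)` (zeroth and first entries)
    {B₀ ρ : ℝ} (hB₀ : 0 ≤ B₀) (hρ : 0 < ρ)
    (h0 : ∀ y y' : PBond (F.P K) k, h1Entry0 F N K k Ω U₀ levB a hpos hQ y y' ≤ B₀ * Real.exp (-(ρ * (Site.tdist y.src y'.src : ℝ))))
    (h1 : ∀ y y' : PBond (F.P K) k, h1Entry1 F N K k Ω U₀ levB a hpos hQ y y' ≤ B₀ * Real.exp (-(ρ * (Site.tdist y.src y'.src : ℝ))))
    -- the radius
    {r' : ℝ} (hr'0 : 0 < r')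
    (hr'le : letI C₂ : ℝ := 12800000000000000 * (F.L : ℝ) * N
      letI c₄ : ℝ := 1 / (200000000000 * (F.L : ℝ) * N)
      letI b : ℝ := B₀ * ((F.P K).d * (2 * (1 + 1 / ρ)) ^ (F.P K).d)
      r' ≤ min (c₄ / 4) (min (1 / 2) (1 / (16 * (b * C₂ + 1)))))
    -- the on-cone entry letter of `D C^{sl}` on `‖A‖ < 2r′`, and the window against `Θ_H = L^{kd}·B₀·d·(2(1+1/ρ))^d`
    {g₀ : ℝ} (hg₀ : 0 ≤ g₀)
    (hg : ∀ A : Space115Lit F N K k Ω U₀, ‖A‖ < r' + r' → ∀ (bb : Bond (F.P K).d (fun _ => (F.P K).sitesPerDir 0)) (X : Matrix (Fin N) (Fin N) ℂ) (c : PBond (F.P K) k),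
      (bondToLit (F.P K) 0).symm bb ∈ bondsIn 0 {x : Site (F.P K) 0 | B14.Eq22Determines.blockIter k x = c.src ∨ B14.Eq22Determines.blockIter k x = c.tgt} →
      ‖NegSup.equiv (levWeight (F.L : ℝ) ((F.P K).eta k) levB 0) (Matrix (Fin N) (Fin N) ℂ)
        (fderiv ℂ (CslOfRecord F N K k Ω U₀ levB) A
          (single115 (lev₁ := pairLevLit F Ω k) (Dc := nabla115 ((F.P K).eta k) (unitsOfRecord F N U₀)) bb X)) c‖ ≤ g₀ * ‖A‖ * ‖X‖)
    (hq : (r' + r') * (((((F.P K).L ^ (F.P K).d) ^ k : ℕ) : ℝ) * (B₀ * ((F.P K).d * (2 * (1 + 1 / ρ)) ^ (F.P K).d))) * (2 * ((F.P K).d : ℝ) * g₀) ≤ 1 / 2)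
    -- (KL-N)
    {hk' : Bond (F.P K).d (fun _ => (F.P K).sitesPerDir 0) → PBond (F.P K) k → ℝ} (hk'0 : ∀ b' y, 0 ≤ hk' b' y)
    (hNk : ∀ (y : PBond (F.P K) k) (Z : Matrix (Fin N) (Fin N) ℂ) (b' : Bond (F.P K).d (fun _ => (F.P K).sitesPerDir 0)),
      ‖NegSup.equiv (levWeight (F.L : ℝ) ((F.P K).eta k) (bondLevLit F Ω k) 3) (Matrix (Fin N) (Fin N) ℂ)
        (DeltaPiCurOfRecord F N K k Ω U₀ Gp (QflatOfRecord F N k) (H1OfRecordAtBgFlat F N K k Ω U₀ levB a hpos hQ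
          ((NegSup.equiv (levWeight (F.L : ℝ) ((F.P K).eta k) levB 0) (Matrix (Fin N) (Fin N) ℂ)).symm (Pi.single y Z)))) b'‖ ≤ hk' b' y * ‖Z‖)
    {Θ' : ℝ} (hΘ'0 : 0 ≤ Θ')
    (hΘ' : ∀ (bb : Bond (F.P K).d (fun _ => (F.P K).sitesPerDir 0)) (y : PBond (F.P K) k),
      ∑ b', levWeight (F.L : ℝ) ((F.P K).eta k) (bondLevLit F Ω k) 3 bb / levWeight (F.L : ℝ) ((F.P K).eta k) (bondLevLit F Ω k) 1 b' * hk' b' y ≤ Θ')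
    {N₁ : ℝ} (hN₁0 : 0 ≤ N₁)
    (hN₁ : ∀ b', ∑ y, levWeight (F.L : ℝ) ((F.P K).eta k) (bondLevLit F Ω k) 3 b' / levWeight (F.L : ℝ) ((F.P K).eta k) levB 0 y * hk' b' y ≤ N₁)
    (hJ : ‖JOfRecordAtBg F N K k Ω U₀‖ ≤ nJ) :
    letI C₂ : ℝ := 12800000000000000 * (F.L : ℝ) * N
    letI b : ℝ := B₀ * ((F.P K).d * (2 * (1 + 1 / ρ)) ^ (F.P K).d)
    letI ΘHw : ℝ := ((((F.P K).L ^ (F.P K).d) ^ k : ℕ) : ℝ) * (B₀ * ((F.P K).d * (2 * (1 + 1 / ρ)) ^ (F.P K).d))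
    letI R' : ℝ := min r' ((1 - 4 * b * C₂ * (r' + r')) * (1 / 16))
    letI CV : ℝ := 1024 * (((F.P K).d - 1 : ℕ) : ℝ) * ((1 : ℝ) * 1) ^ 3 * N * (α * (1 : ℝ) ^ 2 + 1 / 16)
        + (((F.P K).d - 1 : ℕ) : ℝ) * ((1 : ℝ) * 1) ^ 3 * (136 + 2 * ((1 : ℝ) * 1)) * N
    letI G : ℝ := 2 * ((F.P K).d : ℝ) * g₀
    letI θ₃ : ℝ := (2 * (1 / (1 - 4 * b * C₂ * (r' + r'))) + 1) * ΘHw * G / r'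
    letI θE : ℝ := 2 * ΘHw * G * (1 / (1 - 4 * b * C₂ * (r' + r')))
    letI θE' : ℝ := 2 * Θ' * G * (1 / (1 - 4 * b * C₂ * (r' + r')))
    Prop4UniformAtRecord F N K k Ω U₀ levB a hpos hQ r' Gp
      ((N * θ₃ * nJ + (N₁ * C₂ * (1 / (1 - 4 * b * C₂ * (r' + r'))) ^ 2 + N * θE')
        + N * θE * (N₁ * C₂ * (1 / (1 - 4 * b * C₂ * (r' + r'))) ^ 2) * R'
        + N * (1 + θE * R') * CV * (1 / (1 - 4 * b * C₂ * (r' + r'))) ^ 2)) R' := by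
  have hb : 0 ≤ B₀ * ((F.P K).d * (2 * (1 + 1 / ρ)) ^ (F.P K).d) := by positivity
  obtain ⟨hk0, hHk', hΘ, hH1, hHw⟩ := klH_of_h1EntryBounds F N K k Ω U₀ levB a hpos hQ hΩ hkm hB₀ hρ h0
  -- the one-block bound read with this statement's decidability instance inside `Pi.single` (instances are subsingletons)
  have hHk : ∀ (y : PBond (F.P K) k) (Z : Matrix (Fin N) (Fin N) ℂ) (b' : Bond (F.P K).d (fun _ => (F.P K).sitesPerDir 0)),
      ‖flat115 (H1OfRecordAtBgFlat F N K k Ω U₀ levB a hpos hQ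
          ((NegSup.equiv (levWeight (F.L : ℝ) ((F.P K).eta k) levB 0) (Matrix (Fin N) (Fin N) ℂ)).symm (Pi.single y Z))) b'‖ ≤
        ‖h1Col0 F N K k Ω U₀ levB a hpos hQ y b'‖ * ‖Z‖ := fun y Z b' => by
    convert hHk' y Z b' using 6
  exact prop4UniformAtRecord_node00_of_coneLetter_radius F N K k Ω U₀ levB a hpos hQ Gp hkpos hkm hb hΩ hα0 hα hreg
    (prop4LetterHAtRecord_of_h1EntryBounds F N K k Ω U₀ levB a hpos hQ hΩ hB₀ hρ h0 h1) hr'0 hr'le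
    (hk := fun b' y => ‖h1Col0 F N K k Ω U₀ levB a hpos hQ y b'‖) hk0 hHk hΘ hH1 hΘ hHw hg₀ hg hq hk'0 hNk hΘ'0 hΘ' hN₁0 hN₁ hJ

end Record

end Summit.QuantumFields.YangMills.Theorems.Prop4UniformAtRecord

end
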